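import Summits.QuantumFields.YangMills.Theorems.BalabanUVNodesN15KingModelHeatKernelCycle
import HarnessLib

/-!
# BalabanUVNodes ∕ N15 — THE KING-MODEL RUNG (PART Ϣ-e): THE DECAY OF THE CYCLE HEAT KERNEL —
# `‖Q^{(K)}_s(n)‖ ≤ (π∕2)⁴·(14s + 84s²)·(9∕K + √(π∕(8s))) ∕ |v(n)|⁴` for `n ≠ 0`, every `K ≥ 1`, every `s > 0`
# (four summations by parts + the Gaussian localisation of `∂⁴e^{−σ(1−cos)}` on the windows `[θ_k, θ_k + 8π∕K]`; the off-diagonal input of PART Ϣ's η-uniform power law)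
# (Track A, DAG node N15 = NE2; FAN-OUT v1.1 §N15 s3 «KING-MODEL RUNG … + what the curved case adds»; count-neutral)

HONEST FRAMING.  Count-neutral (cell `pub-ymgap`, seat `pub-ymgap-dag-n15-e` g55; `--supports stmt-QuantumFields-27247 --as helper` = K3ᴬ).  One-dimensional, finite sums; the analytic inputs
are PART Ϣ-a (`|∂_θ⁴heat σ| ≤ (7σ+21σ²)e^{−(σ∕2)(1−cos θ)}`), Ϣ-b (`|Δ_[h]^[4]F(θ)| ≤ h⁴·sup_{[θ,θ+4h]}|F⁗|`), Ϣ-c (`K⁻¹Σ_k e^{−(8s∕K²)((|v(k)|−4)₊)²} ≤ 9∕K + √(π∕(8s))`) and Ϣ-d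
(`‖Q_s(n)‖ ≤ ‖ψ(−n)−1‖⁻⁴·K⁻¹Σ_k|Δ⁴_{2π∕K}heat(2s)(θ_k)|`, `‖ψ(−n)−1‖ ≥ 4|v(n)|∕K`).  THIS FILE adds the WINDOW GEOMETRY — on the window `ξ ∈ [θ_k, θ_k + 4·(2π∕K)]` the Gaussian
factor is controlled by the distance of the CLASS `k` from `0`: `1 − cos ξ ≥ 8((|v(k)|−4)₊)²∕K²` (★ `one_sub_cos_ge_window`: `cos ξ ≤ cos α`, `α = 2π(|v|−4)₊∕K ∈ [0,π]`, because the window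
stays inside `[α, 2π−α]` exactly when `2|v| ≤ K` — King's reduced momenta; then Jordan) — and assembles ★★★ **`norm_cycleHeat_le_decay`**.  WHY THE SHAPE MATTERS (PART Ϣ-g): with the
three bounds `‖Q_s‖ ≤ 1`, `‖Q_s‖ ≤ 1∕K + e^{−8s∕K²}√(π∕(8s))` (Ϣ-d) and THIS `‖Q_s(n)‖ ≲ (s+s²)(1∕K + s^{−1∕2})∕|v|⁴`, the time integral `∫₀^∞e^{−(m²∕c)s}Π_μ‖Q_s(z_μ)‖ds` on the
four-torus splits at `s = |v|²` into pieces each `≤ C∕|v|²` WITHOUT using the mass (the mass only enters through the zero mode `8c∕(m²K⁴)`): the factor `s^{−1∕2}` here (the heat-kernel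
localisation `|θ| ≲ s^{−1∕2}`) is indispensable — a bound `(s+s²)∕|v|⁴` alone gives only `1∕|v|`.  NOT a node discharge; nothing continuum ∕ Clay.
CONTENTS.  §1 `cos_le_cos_of_mem_window` (`α ≤ ξ ≤ 2π − α`, `α ∈ [0,π]` ⟹ `cos ξ ≤ cos α`), `one_sub_cos_ge_jordan` (`1 − cos α ≥ 2α²∕π²` on `[0,π]`), ★ **`one_sub_cos_ge_window`**; §2 ★ `abs_fourth_difference_heat_le`
(`|Δ_[2π∕K]^[4]heat(2s)(θ_k)| ≤ (2π∕K)⁴(14s+84s²)e^{−(8s∕K²)((|v(k)|−4)₊)²}`), ★ `cycle_fourth_difference_sum_le` (`K⁻¹Σ_k|…| ≤ (2π∕K)⁴(14s+84s²)(9∕K+√(π∕(8s)))`), `inv_norm_char_pow_four_le`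
(`‖ψ(−n)−1‖⁻⁴ ≤ (K∕(4|v(n)|))⁴`), ★★★ **`norm_cycleHeat_le_decay`**.
PRIOR TREE ART (by name): PART Ϣ-a…Ϣ-d; the tree's `SRWGreen.heat` ∕ `heat_periodic`; Mathlib `Real.cos_le_cos_of_nonneg_of_le_pi`, `Real.mul_le_sin`, `Int.natAbs_eq`.  The tree's
`SRWGreenHeatKernel1D.exists_far_bound_heat` ∕ `exists_near_bound` give `∂^Nheat` bounds for `s ≥ 1` with existential constants on `ℤ`; this file is the CYCLE version with explicit ones.
Dedup (rg at filing): basename 0 files; needles `one_sub_cos_ge_window|abs_fourth_difference_heat_le|cycle_fourth_difference_sum_le|norm_cycleHeat_le_decay|cos_le_cos_of_mem_window` 0 tree files.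
Locators: [King1986] (4.4) p.670 (symbol, reduced momenta `|p′_μ| ≤ π`), proof of Lemma 4.1 p.671 (Jordan), (4.35) p.674; [LawlerLimic2010] §2.3 (method).  0 `sorry`, 0 `def`.
-/

noncomputable section

open Real Set Finset Complex fwdDiff
open scoped BigOperators

namespace Summit.QuantumFields.YangMills.BalabanUVNodes.N15KingModelRung.HeatKernel

open Literature.Barriers.CriticalPhenomena.SRWGreen (heat heat_le_one heat_pos heat_periodic)

variable {K : ℕ} [NeZero K]

/-! ## §1 Window geometry on the cycle -/

omit [NeZero K] in
/-- `cos ξ ≤ cos α` whenever `0 ≤ α ≤ π` and `α ≤ ξ ≤ 2π − α`. [folklore] -/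
theorem cos_le_cos_of_mem_window {α ξ : ℝ} (hα0 : 0 ≤ α) (_hαπ : α ≤ π) (h1 : α ≤ ξ) (h2 : ξ ≤ 2 * π - α) : Real.cos ξ ≤ Real.cos α := by
  rcases le_or_gt ξ π with hξ | hξ
  · exact Real.cos_le_cos_of_nonneg_of_le_pi hα0 hξ h1
  · rw [← Real.cos_two_pi_sub]
    exact Real.cos_le_cos_of_nonneg_of_le_pi hα0 (by linarith) (by linarith)

omit [NeZero K] in
/-- Jordan for `1 − cos`: `2α²∕π² ≤ 1 − cos α` for `0 ≤ α ≤ π` (`1 − cos α = 2sin²(α∕2)`, `sin(α∕2) ≥ (2∕π)(α∕2)`). [cite: King1986, proof of Lemma 4.1 p.671] -/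
theorem one_sub_cos_ge_jordan {α : ℝ} (hα0 : 0 ≤ α) (hαπ : α ≤ π) : 2 * α ^ 2 / π ^ 2 ≤ 1 - Real.cos α := by
  have hs := Real.mul_le_sin (x := α / 2) (by linarith) (by linarith)
  have h0 : 0 ≤ 2 / π * (α / 2) := by positivity
  have hsq := mul_self_le_mul_self h0 hs
  have e : 1 - Real.cos α = 2 * (Real.sin (α / 2) * Real.sin (α / 2)) := by
    have h2 : Real.cos α = Real.cos (2 * (α / 2)) := by ring_nf
    have h3 := Real.sin_sq_add_cos_sq (α / 2)
    rw [h2, Real.cos_two_mul]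
    nlinarith [h3]
  rw [e]
  have e2 : 2 * α ^ 2 / π ^ 2 = 2 * (2 / π * (α / 2) * (2 / π * (α / 2))) := by field_simp
  rw [e2]
  linarith

/-- ★ **WINDOW GEOMETRY**: for every class `k ∈ ℤ∕K` and every `ξ` in the window `[θ_k, θ_k + 4·(2π∕K)]` (`θ_k = 2πv(k)∕K`): `8((|v(k)|−4)₊)²∕K² ≤ 1 − cos ξ` — with `a = |v(k)| ≥ 4`, `α = 2π(a−4)∕K`,
the window lies in `[α, 2π−α]` (for `v ≥ 0`: `2π(a+4)∕K ≤ 2π − α ⟺ 2a ≤ K`, King's `|p′| ≤ π`) or its mirror image (for `v < 0`), so `cos ξ ≤ cos α`, and Jordan. [cite: King1986, (4.4) p.670, proof of Lemma 4.1 p.671] -/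
theorem one_sub_cos_ge_window (k : ZMod K) {ξ : ℝ} (hξ : ξ ∈ Icc (cycAngle K k) (cycAngle K k + 4 * (2 * π / K))) :
    8 * (((k.valMinAbs.natAbs - 4 : ℕ) : ℝ)) ^ 2 / (K : ℝ) ^ 2 ≤ 1 - Real.cos ξ := by
  have hK : (0 : ℝ) < K := by exact_mod_cast Nat.pos_of_ne_zero (NeZero.ne K)
  set a : ℕ := k.valMinAbs.natAbs with ha
  by_cases h4 : a < 4
  · have : (a - 4 : ℕ) = 0 := by omega
    rw [this]; simp; linarith [Real.cos_le_one ξ]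
  push Not at h4
  -- `a ≥ 4`; `2a ≤ K`
  have haK : 2 * a ≤ K := by have := ZMod.natAbs_valMinAbs_le k; omega
  have haR : ((a - 4 : ℕ) : ℝ) = (a : ℝ) - 4 := by push_cast [Nat.cast_sub h4]; ring
  set α : ℝ := 2 * π * ((a : ℝ) - 4) / K with hα
  have hα0 : 0 ≤ α := by have : (4 : ℝ) ≤ a := by exact_mod_cast h4
                         positivity
  have haK' : 2 * (a : ℝ) ≤ K := by exact_mod_cast haK
  have hαπ : α ≤ π := by
    rw [hα, div_le_iff₀ hK]; nlinarith [Real.pi_pos]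
  -- `cos ξ ≤ cos α`
  have hv : (k.valMinAbs : ℝ) = a ∨ (k.valMinAbs : ℝ) = -(a : ℝ) := by
    rcases Int.natAbs_eq k.valMinAbs with h | h
    · left; rw [← ha] at h; exact_mod_cast h
    · right; rw [← ha] at h; exact_mod_cast h
  have hcos : Real.cos ξ ≤ Real.cos α := by
    obtain ⟨hξ1, hξ2⟩ := hξ
    unfold cycAngle at hξ1 hξ2
    rcases hv with h | h
    · rw [h] at hξ1 hξ2
      refine cos_le_cos_of_mem_window hα0 hαπ ?_ ?_
      · have : α ≤ 2 * π * (a : ℝ) / K := by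
          rw [hα]; apply div_le_div_of_nonneg_right _ hK.le; nlinarith [Real.pi_pos]
        linarith
      · have e1 : 2 * π * (a : ℝ) / K + 4 * (2 * π / K) = 2 * π * ((a : ℝ) + 4) / K := by ring
        have e2 : 2 * π - α = 2 * π * ((K : ℝ) - a + 4) / K := by rw [hα]; field_simp; ring
        have : 2 * π * ((a : ℝ) + 4) / K ≤ 2 * π * ((K : ℝ) - a + 4) / K := by
          apply div_le_div_of_nonneg_right _ hK.le; nlinarith [Real.pi_pos]
        linarith
    · rw [h] at hξ1 hξ2
      rw [← Real.cos_neg]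
      refine cos_le_cos_of_mem_window hα0 hαπ ?_ ?_
      · have : -(2 * π * -(a : ℝ) / K + 4 * (2 * π / K)) = α := by rw [hα]; ring
        linarith
      · have : -(2 * π * -(a : ℝ) / K) ≤ π := by
          rw [show -(2 * π * -(a : ℝ) / K) = 2 * π * a / K by ring, div_le_iff₀ hK]; nlinarith [Real.pi_pos]
        linarith
  -- Jordan
  have hj := one_sub_cos_ge_jordan hα0 hαπ
  rw [haR]
  have e : 8 * ((a : ℝ) - 4) ^ 2 / (K : ℝ) ^ 2 = 2 * α ^ 2 / π ^ 2 := by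
    rw [hα]; field_simp; ring
  rw [e]
  linarith

/-! ## §2 The decay bound -/

/-- ★ THE FOURTH DIFFERENCES OF THE HEAT SYMBOL ON THE CYCLE: `|Δ_[2π∕K]^[4]heat(2s)(θ_k)| ≤ (2π∕K)⁴·(14s + 84s²)·e^{−(8s∕K²)((|v(k)|−4)₊)²}` (`s ≥ 0`) — PART Ϣ-b on the chain
`kingHeatChain (2s)`, PART Ϣ-a's localised bound on the window, §1. [cite: King1986, (4.4) p.670] -/
theorem abs_fourth_difference_heat_le {s : ℝ} (hs : 0 ≤ s) (k : ZMod K) :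
    |(Δ_[2 * π / K])^[4] (heat (2 * s)) (cycAngle K k)|
      ≤ (2 * π / K) ^ 4 * ((14 * s + 84 * s ^ 2) * Real.exp (-(8 * s / (K : ℝ) ^ 2) * (((k.valMinAbs.natAbs - 4 : ℕ) : ℝ)) ^ 2)) := by
  have hK : (0 : ℝ) < K := by exact_mod_cast Nat.pos_of_ne_zero (NeZero.ne K)
  have hh : 0 ≤ 2 * π / (K : ℝ) := by positivity
  have hσ : 0 ≤ 2 * s := by positivity
  have hchain : ∀ i < 4, ∀ x, HasDerivAt (kingHeatChain (2 * s) i) (kingHeatChain (2 * s) (i + 1) x) x :=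
    fun i hi x => hasDerivAt_kingHeatChain (2 * s) hi x
  have hB : ∀ ξ ∈ Icc (cycAngle K k) (cycAngle K k + 4 * (2 * π / K)),
      |kingHeatChain (2 * s) 4 ξ| ≤ (14 * s + 84 * s ^ 2) * Real.exp (-(8 * s / (K : ℝ) ^ 2) * (((k.valMinAbs.natAbs - 4 : ℕ) : ℝ)) ^ 2) := by
    intro ξ hξ
    have h1 := abs_kingHeatChain_four_le hσ ξ
    have hwin := one_sub_cos_ge_window k hξ
    have h2 : Real.exp (-(2 * s / 2 * (1 - Real.cos ξ))) ≤ Real.exp (-(8 * s / (K : ℝ) ^ 2) * (((k.valMinAbs.natAbs - 4 : ℕ) : ℝ)) ^ 2) := by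
      apply Real.exp_le_exp.mpr
      have := mul_le_mul_of_nonneg_left hwin hs
      have e : s * (8 * (((k.valMinAbs.natAbs - 4 : ℕ) : ℝ)) ^ 2 / (K : ℝ) ^ 2) = (8 * s / (K : ℝ) ^ 2) * (((k.valMinAbs.natAbs - 4 : ℕ) : ℝ)) ^ 2 := by ring
      rw [e] at this
      have e2 : 2 * s / 2 * (1 - Real.cos ξ) = s * (1 - Real.cos ξ) := by ring
      rw [e2]; linarith
    have e3 : 7 * (2 * s) + 21 * (2 * s) ^ 2 = 14 * s + 84 * s ^ 2 := by ring
    rw [e3] at h1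
    exact h1.trans (mul_le_mul_of_nonneg_left h2 (by positivity))
  have h := abs_iterate_fwdDiff_four_le hchain hh (cycAngle K k) _ hB
  rw [kingHeatChain_zero] at h
  exact h

/-- ★ … summed over the cycle: `K⁻¹Σ_k|Δ_[2π∕K]^[4]heat(2s)(θ_k)| ≤ (2π∕K)⁴(14s + 84s²)(9∕K + √(π∕(8s)))` (`s > 0`; PART Ϣ-c's window sum). [cite: King1986, (4.4) p.670, (4.35) p.674] -/
theorem cycle_fourth_difference_sum_le {s : ℝ} (hs : 0 < s) :
    (K : ℝ)⁻¹ * ∑ k : ZMod K, |(Δ_[2 * π / K])^[4] (heat (2 * s)) (cycAngle K k)|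
      ≤ (2 * π / K) ^ 4 * (14 * s + 84 * s ^ 2) * (9 * (K : ℝ)⁻¹ + Real.sqrt (π / (8 * s))) := by
  have hK : (0 : ℝ) < K := by exact_mod_cast Nat.pos_of_ne_zero (NeZero.ne K)
  have h1 : ∑ k : ZMod K, |(Δ_[2 * π / K])^[4] (heat (2 * s)) (cycAngle K k)|
      ≤ ∑ k : ZMod K, (2 * π / K) ^ 4 * ((14 * s + 84 * s ^ 2) * Real.exp (-(8 * s / (K : ℝ) ^ 2) * (((k.valMinAbs.natAbs - 4 : ℕ) : ℝ)) ^ 2)) :=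
    Finset.sum_le_sum fun k _ => abs_fourth_difference_heat_le hs.le k
  rw [← Finset.mul_sum, ← Finset.mul_sum] at h1
  have hw := cycle_window_sum_le (K := K) hs
  have h0 : 0 ≤ (2 * π / (K : ℝ)) ^ 4 * (14 * s + 84 * s ^ 2) := by positivity
  calc (K : ℝ)⁻¹ * ∑ k : ZMod K, |(Δ_[2 * π / K])^[4] (heat (2 * s)) (cycAngle K k)|
      ≤ (K : ℝ)⁻¹ * ((2 * π / K) ^ 4 * ((14 * s + 84 * s ^ 2) * ∑ k : ZMod K, Real.exp (-(8 * s / (K : ℝ) ^ 2) * (((k.valMinAbs.natAbs - 4 : ℕ) : ℝ)) ^ 2))) :=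
        mul_le_mul_of_nonneg_left h1 (by positivity)
    _ = (2 * π / K) ^ 4 * (14 * s + 84 * s ^ 2) * ((K : ℝ)⁻¹ * ∑ k : ZMod K, Real.exp (-(8 * s / (K : ℝ) ^ 2) * (((k.valMinAbs.natAbs - 4 : ℕ) : ℝ)) ^ 2)) := by ring
    _ ≤ (2 * π / K) ^ 4 * (14 * s + 84 * s ^ 2) * (9 * (K : ℝ)⁻¹ + Real.sqrt (π / (8 * s))) := mul_le_mul_of_nonneg_left hw h0

/-- `‖ψ(−n) − 1‖⁻⁴ ≤ (K∕(4|v(n)|))⁴` for `n ≠ 0` (PART Ϣ-d's Jordan step, inverted). [cite: King1986, proof of Lemma 4.1 p.671] -/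
theorem inv_norm_char_pow_four_le {n : ZMod K} (hn : n ≠ 0) :
    (‖(ZMod.stdAddChar (-n) : ℂ) - 1‖ ^ 4)⁻¹ ≤ ((K : ℝ) / (4 * (n.valMinAbs.natAbs : ℕ))) ^ 4 := by
  have hK : (0 : ℝ) < K := by exact_mod_cast Nat.pos_of_ne_zero (NeZero.ne K)
  have hv : 0 < n.valMinAbs.natAbs := by
    rw [Nat.pos_iff_ne_zero, Ne, Int.natAbs_eq_zero, ZMod.valMinAbs_eq_zero]; exact hn
  have hvR : (0 : ℝ) < ((n.valMinAbs.natAbs : ℕ) : ℝ) := by exact_mod_cast hv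
  have hge := norm_stdAddChar_neg_sub_one_ge n
  have hpos : 0 < 4 * ((n.valMinAbs.natAbs : ℕ) : ℝ) / K := by positivity
  rw [← inv_pow]
  have hinv : (‖(ZMod.stdAddChar (-n) : ℂ) - 1‖)⁻¹ ≤ (K : ℝ) / (4 * (n.valMinAbs.natAbs : ℕ)) := by
    rw [show (K : ℝ) / (4 * (n.valMinAbs.natAbs : ℕ)) = (4 * ((n.valMinAbs.natAbs : ℕ) : ℝ) / K)⁻¹ by rw [inv_div]]
    exact inv_anti₀ hpos hge
  exact pow_le_pow_left₀ (inv_nonneg.mpr (norm_nonneg _)) hinv 4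

/-- ★★★ **THE DECAY OF THE CYCLE HEAT KERNEL**: for every `K ≥ 1`, `s > 0` and `n ≠ 0` in `ℤ∕K`,
`‖Q^{(K)}_s(n)‖ ≤ (π∕2)⁴·(14s + 84s²)·(9∕K + √(π∕(8s))) ∕ |v(n)|⁴` (`v(n) = valMinAbs n`, King's reduced momentum index) — four summations by parts, the mean-value bound on the fourth
differences, the Gaussian localisation of `∂⁴heat`, the window geometry and the Gaussian window sum; no mass, no volume: the constants are absolute. [cite: King1986, (4.4) p.670, (4.35) p.674] -/
theorem norm_cycleHeat_le_decay {s : ℝ} (hs : 0 < s) {n : ZMod K} (hn : n ≠ 0) :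
    ‖cycleHeat K s n‖ ≤ (π / 2) ^ 4 * (14 * s + 84 * s ^ 2) * (9 * (K : ℝ)⁻¹ + Real.sqrt (π / (8 * s))) / ((n.valMinAbs.natAbs : ℕ) : ℝ) ^ 4 := by
  have hK : (0 : ℝ) < K := by exact_mod_cast Nat.pos_of_ne_zero (NeZero.ne K)
  have hv : 0 < n.valMinAbs.natAbs := by
    rw [Nat.pos_iff_ne_zero, Ne, Int.natAbs_eq_zero, ZMod.valMinAbs_eq_zero]; exact hn
  have hvR : (0 : ℝ) < ((n.valMinAbs.natAbs : ℕ) : ℝ) := by exact_mod_cast hv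
  have h1 := norm_cycleHeat_le_of_fourth_difference (K := K) s hn
  have h2 := inv_norm_char_pow_four_le (K := K) hn
  have h3 := cycle_fourth_difference_sum_le (K := K) hs
  have hS0 : 0 ≤ (K : ℝ)⁻¹ * ∑ k : ZMod K, |(Δ_[2 * π / K])^[4] (heat (2 * s)) (cycAngle K k)| :=
    mul_nonneg (by positivity) (Finset.sum_nonneg fun k _ => abs_nonneg _)
  have hC0 : 0 ≤ ((K : ℝ) / (4 * (n.valMinAbs.natAbs : ℕ))) ^ 4 := by positivity
  calc ‖cycleHeat K s n‖ ≤ (‖(ZMod.stdAddChar (-n) : ℂ) - 1‖ ^ 4)⁻¹ * ((K : ℝ)⁻¹ * ∑ k : ZMod K, |(Δ_[2 * π / K])^[4] (heat (2 * s)) (cycAngle K k)|) := h1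
    _ ≤ ((K : ℝ) / (4 * (n.valMinAbs.natAbs : ℕ))) ^ 4 * ((2 * π / K) ^ 4 * (14 * s + 84 * s ^ 2) * (9 * (K : ℝ)⁻¹ + Real.sqrt (π / (8 * s)))) :=
        mul_le_mul h2 h3 hS0 hC0
    _ = (π / 2) ^ 4 * (14 * s + 84 * s ^ 2) * (9 * (K : ℝ)⁻¹ + Real.sqrt (π / (8 * s))) / ((n.valMinAbs.natAbs : ℕ) : ℝ) ^ 4 := by
        field_simp
        ring

/-- The decay bound with the coarse factor `9 + √(π∕(8s))` (using `1∕K ≤ 1`). [cite: King1986, (4.4) p.670] -/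
theorem norm_cycleHeat_le_decay' {s : ℝ} (hs : 0 < s) {n : ZMod K} (hn : n ≠ 0) :
    ‖cycleHeat K s n‖ ≤ (π / 2) ^ 4 * (14 * s + 84 * s ^ 2) * (9 + Real.sqrt (π / (8 * s))) / ((n.valMinAbs.natAbs : ℕ) : ℝ) ^ 4 := by
  have hK1 : (1 : ℝ) ≤ K := by exact_mod_cast Nat.one_le_iff_ne_zero.mpr (NeZero.ne K)
  refine (norm_cycleHeat_le_decay hs hn).trans ?_
  have hinv : (K : ℝ)⁻¹ ≤ 1 := inv_le_one_of_one_le₀ hK1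
  gcongr
  linarith

end Summit.QuantumFields.YangMills.BalabanUVNodes.N15KingModelRung.HeatKernel

end
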